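import Summits.QuantumFields.YangMills.Theorems.BalabanUVNodesN22GenSchemasOfAnalyticReading
import Summits.QuantumFields.YangMills.Theorems.BalabanUVNodesN22AtRecordOfGenStepLipschitz

/-!
# BalabanUVNodes ∕ node N22 = NE9 — ROAD 1's LETTERS FROM THE ANALYTIC READING READ DIRECTLY: geometrically fading first-order coupling letters `ℓ₁ μ^{age}` of the generated
# terms at ANY rate `μ ≥ max(ω₁, 4M_b c_w∕ϱ)` — the reading's age contraction `ω₁` and the margin ratio need not ADD UP (pub-balaban's `fade_of_radius` ∕ module J61 ask
# `ω₁ + 4M_b c_w∕ϱ`), by strong induction on node00-def-W1's recursion; the `hlet` shape for the run towers (module J65 reads it at the record under `μ ≤ ℓ.ω`)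

Cell `pub-ymgap`, HUMAN RULING D-0062 (Track A), R134 seat `pub-ymgap-dag-n22-c` (strategy s1), generation 18, module J64.  THEOREMS ONLY (no `def`, no `sorry`, standard axioms);
`--kind proof --supports stmt-QuantumFields-27366 --as helper` (K3⁸ `SpineGivenEndpointR13SepCoPHV`), COUNT-NEUTRAL.  Imports module J57 `…N22GenSchemasOfAnalyticReading`
(`norm_sub_le_of_ballMargin`) and module J56 `…N22AtRecordOfGenStepLipschitz` (through it J55's `coordLetter_box_truncRun`, J38's `update_mem_window`, J39's `histPrefix_update`).
Nothing re-declared.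

WHY (ROAD 1's analogue of module J62).  Module J61 closes K3's `h9` on ROAD 1 from the analytic reading (AR) through J51's SUM-channel recursion (`renewalSuper_geometric`): letters
`ℓ₁(ω₁ + c)^{age}`, `c = 4M_b c_w∕ϱ`, clause `ω₁ + 4M_b c_w∕ϱ ≤ ℓ.ω`.  A sup-type reading bounds the new term's variation by the MAXIMUM of the weighted older variations: read
DIRECTLY, the letters are `ℓ₁ μ^{age}` for every `μ ≥ ω₁` with `μ ≥ 4M_b c_w∕ϱ` — §1 ★★ `termLipschitzFading_toClusterTower_of_analyticReading` (strong induction on the creation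
step: levels `j ≤ i` do not read `g_i`; levels `i < j ≤ k` contribute `c_w ω₁^{k−j}·ℓ₁ μ^{j−1−i} ≤ c_w ℓ₁ μ^{k−1−i}`; times `4M_b∕ϱ ≤ μ`), §2 ★ `coordLetter_box_truncRun_toClusterTower_
of_analyticReading` (the box-history ∕ run-tower shape = dag-n22-w5's `hlet` with `Λt n i = ℓ₁ μ^{n−1−i}`).  So ROAD 1's clause in the analytic currency is **`max(ω₁, 4M_b c_w∕ϱ) ≤ ℓ.ω`**
(module J65), not the sum: fading memory on ROAD 1 holds as soon as BOTH the contraction of the older terms' influence and the analyticity-margin ratio are below the record's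
fading ratio `ω`.

HONEST FRAMING (binding).  Count-neutral COMPOSITION by a direct induction over def-W1's recursion; (AR), the last-coupling schema and (Adm-run) are DISPLAYED HYPOTHESES (cell's
readings of [II] (2.14)–(2.15) p. 15 and [I] p. 263 (1.17); GAPS G-ne9p2-5, G-t4-U3-1; producer: node N10 ∕ NODE A on def-T's generator of record; inhabited by every generator
ignoring `(z, old)` within the output bound — A5, conditional content); NO estimate of Bałaban's is proved or asserted; nothing of the record is constructed or claimed to meet the
displayed inputs.  N22 is NOT discharged (typed 28∕28 · discharged 5∕27 UNCHANGED); K3⁸ OPEN and NOT claimed; NE9 is NOT IN PRINT for d = 4; no count claim; one finite 𝕋⁴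
programme at fixed ε — R4 closes the CONDITIONAL rung `BalabanLadder.UV` only; NOTHING about the continuum limit, ℝ⁴, infinite volume, OS axioms, a mass gap or the Clay problem
is proved or claimed.  References (TYPES only): [I] = Bałaban, CMP 109 (1987) (0.23) p. 256, §1 p. 263, (2.12)–(2.13) p. 268, §5 p. 298; [II] = CMP 116 (1988) (1.41) p. 11,
(2.13)–(2.15) pp. 14–15, p. 18.
-/

noncomputable section

open Set Metric
open scoped BigOperators

namespace YMDAG.N22.TermRecursion

open Literature.MathematicalPhysics.QuantumFieldTheory.Balaban1983to89
open Literature.MathematicalPhysics.QuantumFieldTheory.Balaban1983to89.T4OutputRate (Window)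
open Literature.MathematicalPhysics.QuantumFieldTheory.Balaban1983to89.Node00.Sect2 (domSys CPair)
open Literature.MathematicalPhysics.QuantumFieldTheory.Balaban1983to89.Node00.W1
open YMDAG.N22.KernelFading (update_mem_window)
open YMDAG.N22.WindowedSecondDiff (histPrefix_update)

/-! ## §1–§2 Fading letters of the generated terms read directly from the analytic reading (one generator `G`, space table `sp`, admissibility `Adm`) -/
section Gen

variable {P : Params} {𝔸 : Type} {M : ℕ} (G : GenTower P 𝔸 M) (sp : (k : ℕ) → (domSys P M (k + 1)).Dom → Set (CPair P 𝔸))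
  (Adm : (k : ℕ) → OlderTerms P 𝔸 M k → Prop)
  {Pot : ℕ → Type*} [∀ k, NormedAddCommGroup (Pot k)] [∀ k, NormedSpace ℂ (Pot k)]
  (ρ : (k : ℕ) → OlderTerms P 𝔸 M k → Pot k) (A : (k : ℕ) → ℝ → CPair P 𝔸 → (domSys P M (k + 1)).Dom → Pot k → ℂ)

/-- ★★ **GEOMETRICALLY FADING FIRST-ORDER COUPLING LETTERS FROM THE ANALYTIC READING READ DIRECTLY — RATE `μ ≥ max(ω₁, 4M_b c_w∕ϱ)`, NOT `ω₁ + 4M_b c_w∕ϱ`.**  (AR-fact)∕(AR-holo)∕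
(AR-adm)∕(AR-dom₁) with age weights `0 ≤ aw k j ≤ c_w·ω₁^{k−j}` (`ω₁ ≥ 0`), (Adm-run), the first-order LAST-coupling schema (`lam ≤ ℓ₁`), and a rate `μ` with **`ω₁ ≤ μ`** and
**`4M_b c_w∕ϱ ≤ μ`** ⟹ for every creation step `k + 1`, window history `g`, coordinate `i`, values `s, s′ ∈ ]0, γ]`, domain `X`, admissible `φ`:
**`‖E^{(k+1)}(X; g∣g_i:=s; φ) − E^{(k+1)}(X; g∣g_i:=s′; φ)‖ ≤ ℓ₁·μ^{k−i}·e^{−κd_{k+1}(X)}·|s − s′|`** — strong induction on `k` over def-W1's recursion: `i > k` not read; `i = k` the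
last-coupling schema; `i < k` `norm_sub_le_of_ballMargin` at the read generated families, whose weighted entries at the levels `j ≤ i` VANISH (prefix dependence) and at the levels
`i < j ≤ k` are `≤ c_w ω₁^{k−j}·ℓ₁ μ^{j−1−i}|s − s′| ≤ c_w ℓ₁ μ^{k−1−i}|s − s′|` (`ω₁ ≤ μ`), times `4M_b∕ϱ`, `≤ ℓ₁ μ^{k−i}|s − s′|` (`4M_b c_w∕ϱ ≤ μ`).  A sup-type reading bounds by
the MAXIMUM over the older levels, so the age contraction `ω₁` and the margin ratio need not ADD UP below the record's fading ratio (pub-balaban's `fade_of_radius` ∕ J61: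
`ω₁ + 4M_b c_w∕ϱ ≤ ℓ.ω`) — each below it suffices (module J65: `max ≤ ℓ.ω`). [folklore] -/
theorem termLipschitzFading_toClusterTower_of_analyticReading {γ κ R r₀ ϱ Mb ℓ₁ cw ω₁ μ : ℝ} {aw : ℕ → ℕ → ℝ} {lam : ℕ → ℝ}
    (hϱ : 0 < ϱ) (hR : r₀ + ϱ < R)
    (hGA : ∀ (k : ℕ), ∀ t ∈ Ioc (0 : ℝ) γ, ∀ (old : OlderTerms P 𝔸 M k), Adm k old → ∀ (X : (domSys P M (k + 1)).Dom), ∀ φ ∈ sp k X,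
      (G k).E ((t : ℝ) : ℂ) old φ X = A k t φ X (ρ k old))
    (hA : ∀ (k : ℕ), ∀ t ∈ Ioc (0 : ℝ) γ, ∀ (X : (domSys P M (k + 1)).Dom), ∀ φ ∈ sp k X, DifferentiableOn ℂ (A k t φ X) (ball 0 R))
    (hMb : ∀ (k : ℕ), ∀ t ∈ Ioc (0 : ℝ) γ, ∀ (X : (domSys P M (k + 1)).Dom), ∀ φ ∈ sp k X, ∀ p ∈ ball (0 : Pot k) R,
      ‖A k t φ X p‖ ≤ Mb * Real.exp (-(κ * (domSys P M (k + 1)).dj X)))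
    (hAdmr : ∀ (k : ℕ) (old : OlderTerms P 𝔸 M k), Adm k old → ‖ρ k old‖ ≤ r₀)
    (hρ₁ : ∀ (k : ℕ) (o o' : OlderTerms P 𝔸 M k), Adm k o → Adm k o' → ∀ (B : ℝ), 0 ≤ B →
      (∀ (k' : ℕ) (hk' : k' < k) (Y : (domSys P M (k' + 1)).Dom), ∀ φ' ∈ sp k' Y,
        aw k (k' + 1) * (Real.exp (κ * (domSys P M (k' + 1)).dj Y) * ‖o ⟨k' + 1, Nat.succ_lt_succ hk'⟩ Y φ' - o' ⟨k' + 1, Nat.succ_lt_succ hk'⟩ Y φ'‖) ≤ B) →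
      ‖ρ k o - ρ k o'‖ ≤ B)
    (haw : ∀ k j, 0 ≤ aw k j) (hawω : ∀ k j, j ≤ k → aw k j ≤ cw * ω₁ ^ (k - j)) (hcw : 0 ≤ cw) (hω₁ : 0 ≤ ω₁)
    (hAdm : ∀ g ∈ Window γ, ∀ k, Adm k (olderOf (recTerm G fun n => ((g n : ℝ) : ℂ)) k))
    (hGt : ∀ (k : ℕ), ∀ t ∈ Ioc (0 : ℝ) γ, ∀ t' ∈ Ioc (0 : ℝ) γ, ∀ (old : OlderTerms P 𝔸 M k), Adm k old → ∀ (X : (domSys P M (k + 1)).Dom), ∀ φ ∈ sp k X,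
      ‖(G k).E ((t : ℝ) : ℂ) old φ X - (G k).E ((t' : ℝ) : ℂ) old φ X‖ ≤ Real.exp (-(κ * (domSys P M (k + 1)).dj X)) * (lam k * |t - t'|))
    (hlam : ∀ k, lam k ≤ ℓ₁) (hℓ₁ : 0 ≤ ℓ₁) (hω₁μ : ω₁ ≤ μ) (hCμ : 4 * Mb * cw / ϱ ≤ μ) :
    ∀ (k : ℕ), ∀ g ∈ Window γ, ∀ (i : ℕ), ∀ s ∈ Ioc (0 : ℝ) γ, ∀ s' ∈ Ioc (0 : ℝ) γ, ∀ (X : (domSys P M (k + 1)).Dom), ∀ φ ∈ sp k X,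
      ‖termC (toClusterTower G) (k + 1) X (Function.update g i s) φ - termC (toClusterTower G) (k + 1) X (Function.update g i s') φ‖ ≤
        ℓ₁ * μ ^ (k - i) * Real.exp (-(κ * (domSys P M (k + 1)).dj X)) * |s - s'| := by
  have hμ : 0 ≤ μ := hω₁.trans hω₁μ
  intro k
  induction k using Nat.strong_induction_on with
  | _ k ih =>
  intro g hg i s hs s' hs' X φ hφ
  set e : ℝ := Real.exp (-(κ * (domSys P M (k + 1)).dj X)) with he
  have he0 : 0 < e := Real.exp_pos _
  rcases lt_trichotomy i k with hik | rfl | hki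
  · -- `i < k`: through the older terms, by the MAXIMUM over the older levels
    have hgs : Function.update g i s ∈ Window γ := update_mem_window hg i hs
    have hgs' : Function.update g i s' ∈ Window γ := update_mem_window hg i hs'
    have hki : k ≠ i := ne_of_gt hik
    rw [termC_toClusterTower, termC_toClusterTower, recTerm_succ, recTerm_succ, Function.update_of_ne hki, Function.update_of_ne hki,
      hGA k (g k) (hg k) _ (hAdm _ hgs k) X φ hφ, hGA k (g k) (hg k) _ (hAdm _ hgs' k) X φ hφ]
    have hB' : 0 ≤ cw * (ℓ₁ * μ ^ (k - 1 - i)) * |s - s'| := by positivity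
    have hent : ∀ (k' : ℕ) (hk' : k' < k) (Y : (domSys P M (k' + 1)).Dom), ∀ φ' ∈ sp k' Y,
        aw k (k' + 1) * (Real.exp (κ * (domSys P M (k' + 1)).dj Y) *
          ‖olderOf (recTerm G fun n => ((Function.update g i s n : ℝ) : ℂ)) k ⟨k' + 1, Nat.succ_lt_succ hk'⟩ Y φ' -
            olderOf (recTerm G fun n => ((Function.update g i s' n : ℝ) : ℂ)) k ⟨k' + 1, Nat.succ_lt_succ hk'⟩ Y φ'‖) ≤ cw * (ℓ₁ * μ ^ (k - 1 - i)) * |s - s'| := by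
      intro k' hk' Y φ' hφ'
      rw [olderOf_apply, olderOf_apply, ← termC_toClusterTower, ← termC_toClusterTower]
      by_cases hk'i : k' < i
      · -- the level `k' + 1 ≤ i` does not read `g_i`
        rw [termC_congr_prefix (toClusterTower G) (k' + 1) Y (g := Function.update g i s) (g' := Function.update g i s')
          (fun n hn => by rw [Function.update_of_ne (by omega), Function.update_of_ne (by omega)]) φ', sub_self, norm_zero, mul_zero, mul_zero]
        exact hB'
      · -- `i ≤ k' < k`: the induction hypothesis, `ω₁^{k−k'−1}·μ^{k'−i} ≤ μ^{k−1−i}`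
        have hik' : i ≤ k' := Nat.not_lt.mp hk'i
        have h := ih k' hk' g hg i s hs s' hs' Y φ' hφ'
        have hpos : 0 < Real.exp (κ * (domSys P M (k' + 1)).dj Y) := Real.exp_pos _
        have h2 : Real.exp (κ * (domSys P M (k' + 1)).dj Y) *
            ‖termC (toClusterTower G) (k' + 1) Y (Function.update g i s) φ' - termC (toClusterTower G) (k' + 1) Y (Function.update g i s') φ'‖ ≤
              ℓ₁ * μ ^ (k' - i) * |s - s'| := by
          calc _ ≤ Real.exp (κ * (domSys P M (k' + 1)).dj Y) * (ℓ₁ * μ ^ (k' - i) * Real.exp (-(κ * (domSys P M (k' + 1)).dj Y)) * |s - s'|) :=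
                mul_le_mul_of_nonneg_left h hpos.le
            _ = ℓ₁ * μ ^ (k' - i) * |s - s'| := by rw [Real.exp_neg]; field_simp
        have hpow : ω₁ ^ (k - (k' + 1)) * μ ^ (k' - i) ≤ μ ^ (k - 1 - i) := by
          calc ω₁ ^ (k - (k' + 1)) * μ ^ (k' - i) ≤ μ ^ (k - (k' + 1)) * μ ^ (k' - i) :=
                mul_le_mul_of_nonneg_right (pow_le_pow_left₀ hω₁ hω₁μ _) (pow_nonneg hμ _)
            _ = μ ^ (k - 1 - i) := by rw [← pow_add]; congr 1; omega
        calc _ ≤ aw k (k' + 1) * (ℓ₁ * μ ^ (k' - i) * |s - s'|) := mul_le_mul_of_nonneg_left h2 (haw _ _)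
          _ ≤ cw * ω₁ ^ (k - (k' + 1)) * (ℓ₁ * μ ^ (k' - i) * |s - s'|) := mul_le_mul_of_nonneg_right (hawω k (k' + 1) (by omega)) (by positivity)
          _ = cw * (ℓ₁ * (ω₁ ^ (k - (k' + 1)) * μ ^ (k' - i))) * |s - s'| := by ring
          _ ≤ cw * (ℓ₁ * μ ^ (k - 1 - i)) * |s - s'| := by gcongr
    have hρ := hρ₁ k _ _ (hAdm _ hgs k) (hAdm _ hgs' k) _ hB' hent
    have h := norm_sub_le_of_ballMargin hϱ hR (hA k (g k) (hg k) X φ hφ) (hMb k (g k) (hg k) X φ hφ) (hAdmr k _ (hAdm _ hgs k)) (hAdmr k _ (hAdm _ hgs' k))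
    have hr₀ : 0 ≤ r₀ := (norm_nonneg _).trans (hAdmr k _ (hAdm _ hgs k))
    have hMb0 : 0 ≤ Mb := by
      have h0 := hMb k (g k) (hg k) X φ hφ 0 (mem_ball_self (by linarith))
      exact nonneg_of_mul_nonneg_left ((norm_nonneg _).trans h0) he0
    have hpowk : μ ^ (k - 1 - i) * μ = μ ^ (k - i) := by rw [← pow_succ]; congr 1; omega
    calc _ ≤ 4 * (Mb * e) / ϱ * ‖ρ k (olderOf (recTerm G fun n => ((Function.update g i s n : ℝ) : ℂ)) k) -
          ρ k (olderOf (recTerm G fun n => ((Function.update g i s' n : ℝ) : ℂ)) k)‖ := h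
      _ ≤ 4 * (Mb * e) / ϱ * (cw * (ℓ₁ * μ ^ (k - 1 - i)) * |s - s'|) := mul_le_mul_of_nonneg_left hρ (by positivity)
      _ = 4 * Mb * cw / ϱ * (ℓ₁ * μ ^ (k - 1 - i) * e * |s - s'|) := by ring
      _ ≤ μ * (ℓ₁ * μ ^ (k - 1 - i) * e * |s - s'|) := mul_le_mul_of_nonneg_right hCμ (by positivity)
      _ = ℓ₁ * (μ ^ (k - 1 - i) * μ) * e * |s - s'| := by ring
      _ = ℓ₁ * μ ^ (k - i) * e * |s - s'| := by rw [hpowk]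
  · -- `i = k`: the last coupling
    rw [termC_toClusterTower, termC_toClusterTower, recTerm_succ, recTerm_succ, olderOf_recTerm_update_of_le G g le_rfl s,
      olderOf_recTerm_update_of_le G g le_rfl s', Function.update_self, Function.update_self, Nat.sub_self, pow_zero, mul_one]
    have h := hGt i s hs s' hs' _ (hAdm g hg i) X φ hφ
    calc _ ≤ e * (lam i * |s - s'|) := h
      _ ≤ e * (ℓ₁ * |s - s'|) := by gcongr; exact hlam i
      _ = ℓ₁ * e * |s - s'| := by ring
  · -- `i > k`: not read
    rw [termC_congr_prefix (toClusterTower G) (k + 1) X (g := Function.update g i s) (g' := Function.update g i s')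
      (fun n hn => by rw [Function.update_of_ne (by omega), Function.update_of_ne (by omega)]) φ, sub_self, norm_zero]
    positivity

/-- ★ **THE FADING LETTERS IN THE BOX-HISTORY SHAPE FOR node00-def-W1's RUN TOWERS** (every run length `K`): under the inputs above and `0 < γ`, for `S = truncRun K (toClusterTower G)`,
`g ∈ box γ k`, `i : Fin (k+1)`, `t ∈ ]0, γ]`: **`‖(S k).E g φ X − (S k).E (g∣g_i:=t) φ X‖ ≤ ℓ₁ μ^{k−i}·e^{−κd_{k+1}(X)}·|g_i − t|`** — the `hlet` shape of dag-n22-w5's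
`ne9_EA_objectsOfRecord₁₃_of_outputCoordLetters` with `Λt n i = ℓ₁ μ^{n−1−i}` (window extension by `γ`, `termC_succ`, J39's `histPrefix_update`, J55's `coordLetter_box_truncRun`).
[folklore] -/
theorem coordLetter_box_truncRun_toClusterTower_of_analyticReading {γ κ R r₀ ϱ Mb ℓ₁ cw ω₁ μ : ℝ} {aw : ℕ → ℕ → ℝ} {lam : ℕ → ℝ}
    (hγ : 0 < γ) (hϱ : 0 < ϱ) (hR : r₀ + ϱ < R)
    (hGA : ∀ (k : ℕ), ∀ t ∈ Ioc (0 : ℝ) γ, ∀ (old : OlderTerms P 𝔸 M k), Adm k old → ∀ (X : (domSys P M (k + 1)).Dom), ∀ φ ∈ sp k X,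
      (G k).E ((t : ℝ) : ℂ) old φ X = A k t φ X (ρ k old))
    (hA : ∀ (k : ℕ), ∀ t ∈ Ioc (0 : ℝ) γ, ∀ (X : (domSys P M (k + 1)).Dom), ∀ φ ∈ sp k X, DifferentiableOn ℂ (A k t φ X) (ball 0 R))
    (hMb : ∀ (k : ℕ), ∀ t ∈ Ioc (0 : ℝ) γ, ∀ (X : (domSys P M (k + 1)).Dom), ∀ φ ∈ sp k X, ∀ p ∈ ball (0 : Pot k) R,
      ‖A k t φ X p‖ ≤ Mb * Real.exp (-(κ * (domSys P M (k + 1)).dj X)))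
    (hAdmr : ∀ (k : ℕ) (old : OlderTerms P 𝔸 M k), Adm k old → ‖ρ k old‖ ≤ r₀)
    (hρ₁ : ∀ (k : ℕ) (o o' : OlderTerms P 𝔸 M k), Adm k o → Adm k o' → ∀ (B : ℝ), 0 ≤ B →
      (∀ (k' : ℕ) (hk' : k' < k) (Y : (domSys P M (k' + 1)).Dom), ∀ φ' ∈ sp k' Y,
        aw k (k' + 1) * (Real.exp (κ * (domSys P M (k' + 1)).dj Y) * ‖o ⟨k' + 1, Nat.succ_lt_succ hk'⟩ Y φ' - o' ⟨k' + 1, Nat.succ_lt_succ hk'⟩ Y φ'‖) ≤ B) →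
      ‖ρ k o - ρ k o'‖ ≤ B)
    (haw : ∀ k j, 0 ≤ aw k j) (hawω : ∀ k j, j ≤ k → aw k j ≤ cw * ω₁ ^ (k - j)) (hcw : 0 ≤ cw) (hω₁ : 0 ≤ ω₁)
    (hAdm : ∀ g ∈ Window γ, ∀ k, Adm k (olderOf (recTerm G fun n => ((g n : ℝ) : ℂ)) k))
    (hGt : ∀ (k : ℕ), ∀ t ∈ Ioc (0 : ℝ) γ, ∀ t' ∈ Ioc (0 : ℝ) γ, ∀ (old : OlderTerms P 𝔸 M k), Adm k old → ∀ (X : (domSys P M (k + 1)).Dom), ∀ φ ∈ sp k X,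
      ‖(G k).E ((t : ℝ) : ℂ) old φ X - (G k).E ((t' : ℝ) : ℂ) old φ X‖ ≤ Real.exp (-(κ * (domSys P M (k + 1)).dj X)) * (lam k * |t - t'|))
    (hlam : ∀ k, lam k ≤ ℓ₁) (hℓ₁ : 0 ≤ ℓ₁) (hω₁μ : ω₁ ≤ μ) (hCμ : 4 * Mb * cw / ϱ ≤ μ) (K : ℕ) :
    ∀ (k : ℕ), ∀ g ∈ box γ k, ∀ (i : Fin (k + 1)), ∀ t ∈ Ioc (0 : ℝ) γ, ∀ (X : (domSys P M (k + 1)).Dom), ∀ φ ∈ sp k X,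
      ‖(truncRun K (toClusterTower G) k).E g φ X - (truncRun K (toClusterTower G) k).E (Function.update g i t) φ X‖ ≤
        ℓ₁ * μ ^ (k - (i : ℕ)) * Real.exp (-(κ * (domSys P M (k + 1)).dj X)) * |g i - t| := by
  have hL := termLipschitzFading_toClusterTower_of_analyticReading G sp Adm ρ A hϱ hR hGA hA hMb hAdmr hρ₁ haw hawω hcw hω₁ hAdm hGt hlam hℓ₁ hω₁μ hCμ
  have hμ : 0 ≤ μ := hω₁.trans hω₁μ
  refine coordLetter_box_truncRun (toClusterTower G) sp K (T := fun k i => ℓ₁ * μ ^ (k - i)) (fun k i => by positivity) ?_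
  intro k gb hgb i t ht X φ hφ
  -- extend the box history to a window history by `γ`
  obtain ⟨g, hg⟩ : ∃ g : ℕ → ℝ, g = fun n => if h : n < k + 1 then gb ⟨n, h⟩ else γ := ⟨_, rfl⟩
  have hgn : ∀ n (hn : n < k + 1), g n = gb ⟨n, hn⟩ := fun n hn => by rw [hg]; exact dif_pos hn
  have hres : Node00.U3OfKernels.histPrefix g k = gb := funext fun j => hgn j j.2
  have hgW : g ∈ Window γ := by
    intro n
    by_cases hn : n < k + 1
    · rw [hgn n hn]; exact hgb ⟨n, hn⟩
    · have e : g n = γ := by rw [hg]; exact dif_neg hn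
      rw [e]; exact ⟨hγ, le_rfl⟩
  have hgi : g i ∈ Ioc (0 : ℝ) γ := hgW i
  have key := hL k g hgW i (g i) hgi t ht X φ hφ
  have hr : ∀ s : ℝ, termC (toClusterTower G) (k + 1) X (Function.update g i s) φ = (toClusterTower G k).E (Function.update gb i s) φ X := fun s => by
    rw [termC_succ, show restrictPrefix k (Function.update g (i : ℕ) s) = Node00.U3OfKernels.histPrefix (Function.update g (i : ℕ) s) k from rfl,
      histPrefix_update g k i.2, hres]
  have hgi' : g i = gb i := by rw [hgn i i.2]
  rw [hr, hr, hgi', Function.update_eq_self] at key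
  exact key

end Gen

end YMDAG.N22.TermRecursion

end
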